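import Summits.AtomisticToContinuum.BoseEinsteinCondensation.Theses.BECPhononFloor
import Literature.MathematicalPhysics.QuantumManyBody.BoseGasThermodynamicLimitRuelle

/-!
# `MesoscopicTail` (stmt-AtomisticToContinuum-11454): typed split `LocalisedDepletion → FourierTail → MesoscopicTail`

Route `BECPhononFloor` of `AtomisticToContinuum/BoseEinsteinCondensation`; crux-strategist decomposition
(seat `planner-cstrat-stmt-AtomisticToContinuum-11454-r1`, BC2 redirect of the RESTATED re-audit) of the crux
`MesoscopicTail` (no occupation shoulder below the healing momentum for thermodynamic-torus near-minimisers)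
into the two pieces foreseen by the route's two-layer plan, typed over the route file's own vocabulary:

* `LocalisedDepletion` (physics, GP scale): for every repulsive finite-range `v`, every box-scale parameter
  `Λ₀ > 0` and `ε > 0`, at small density, eventually in `N`, every `δ`-near-minimiser `Ψ` of the periodic energy
  on the torus of side `L = (N/ρ)^{1/3}` is locally condensed into the constant modes of EVERY partition of the
  torus into `P³` congruent boxes of side `L/P ≤ Λ₀/√ρ` (a fixed multiple `Λ₀√(8πa)` of the healing length, or
  finer): `N ≤ Σ_q ⟨u_q, γ_Ψ u_q⟩ + εN`, `u_q = (L/P)^{-3/2} 1_{box q}`;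
* `FourierTail` (kinematics, no energy): there is an absolute `C > 0` such that for every periodic state `Ψ`,
  every partition into `P³` boxes and all `m + 1 ≥ P`, the plane-wave occupation of the cube shell
  `{m+1 ≤ |n|_∞ ≤ M}` is at most `C·P/(m+1)·N + C·(N − Σ_q ⟨u_q, γ_Ψ u_q⟩)` (operator inequality
  `Π ≤ 2EΠE + 2QΠQ` for the box-constant projection `E = Σ_q |u_q⟩⟨u_q|`, `Q = 1 − E`, and the sinc-tail bound
  `‖Π_{|n|_∞ ≥ m+1} E‖² ≤ (12/π²)·P/(m+1)` for `P ≤ m+1`; `C = 3` works).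

`mesoscopicTail_of_subs : LocalisedDepletion → FourierTail → MesoscopicTail` (children INLINED so that
`ledger route edit --split MesoscopicTail --into children.json --glue-by
Summit.AtomisticToContinuum.BoseEinsteinCondensation.Theorems.mesoscopicTail_of_subs` matches the rendered children by
`δ`-unfolding). Proof: given `K₀, ε`, take `C` from `FourierTail`, put `Λ₀ := 4π/K₀ + 8πC/(K₀ε)`, apply
`LocalisedDepletion` at `(Λ₀, ε/(2C))`; eventually in `N` one has `L√ρ ≥ Λ₀` (`L = (N/ρ)^{1/3} → ∞`, `tendsto_sideLength_atTop`); for a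
near-minimiser and a shell `K₀L√ρ/2π ≤ m+1` take `P := ⌈L√ρ/Λ₀⌉`, so that `L/P ≤ Λ₀/√ρ`, `P ≤ m+1` and
`C·P/(m+1) ≤ ε/2`; then the shell occupation is `≤ (ε/2)N + C·(ε/(2C))N = εN`. Pure bookkeeping
(`trivial_seam`): the content sits in the two pieces. No `def`s, no `sorry`, standard axioms. [folklore]
-/

noncomputable section

open Filter
open scoped ENNReal NNReal BigOperators

namespace Summit.AtomisticToContinuum.BoseEinsteinCondensation.Theorems

open Literature.MathematicalPhysics.QuantumManyBody.BoseGas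
open Summit.AtomisticToContinuum.BoseEinsteinCondensation.Theses.BECPhononFloor

/-- **Split glue for `MesoscopicTail` (stmt-AtomisticToContinuum-11454).**
`LocalisedDepletion → FourierTail → MesoscopicTail`, both children inlined verbatim (shape `C₁ → C₂ → C`
for `ledger route edit --split MesoscopicTail … --glue-by`). [folklore] -/
theorem mesoscopicTail_of_subs :
    (∀ v : ℝ → ENNReal, Literature.MathematicalPhysics.QuantumManyBody.BoseGas.IsRepulsiveFiniteRange v → ∀ Λ₀ : ℝ, 0 < Λ₀ → ∀ ε : ℝ, 0 < ε → ∃ ρ₀ : ℝ, 0 < ρ₀ ∧ ∀ ρ : ℝ, 0 < ρ → ρ < ρ₀ → ∀ᶠ N : ℕ in Filter.atTop, ∃ δ : ENNReal, 0 < δ ∧ ∀ Ψ : Literature.MathematicalPhysics.QuantumManyBody.BoseGas.PeriodicTrialState N (Literature.MathematicalPhysics.QuantumManyBody.BoseGas.sideLength ρ N), Literature.MathematicalPhysics.QuantumManyBody.BoseGas.periodicEnergy v Ψ ≤ Literature.MathematicalPhysics.QuantumManyBody.BoseGas.periodicGroundStateEnergy v N (Literature.MathematicalPhysics.QuantumManyBody.BoseGas.sideLength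 ρ N) + δ → ∀ P : ℕ, 0 < P → Literature.MathematicalPhysics.QuantumManyBody.BoseGas.sideLength ρ N / (P : ℝ) ≤ Λ₀ / Real.sqrt ρ → (N : ENNReal) ≤ (∑ q : Fin 3 → Fin P, Literature.MathematicalPhysics.QuantumManyBody.BoseGas.cellOccupation N (Literature.MathematicalPhysics.QuantumManyBody.BoseGas.sideLength ρ N) (fun x => Literature.MathematicalPhysics.QuantumManyBody.BoseGas.constantMode (Literature.MathematicalPhysics.QuantumManyBody.BoseGas.sideLength ρ N / (P : ℝ)) (x - WithLp.toLp 2 (fun i => Literature.MathematicalPhysics.QuantumManyBody.BoseGas.sideLength ρ N / (P : ℝ) * ((q i : ℕ) : ℝ)))) Ψ.ψ) + ENNReal.ofReal (ε * N)) →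
    (∃ C : ℝ, 0 < C ∧ ∀ N : ℕ, ∀ L : ℝ, 0 < L → ∀ P : ℕ, 0 < P → ∀ Ψ : Literature.MathematicalPhysics.QuantumManyBody.BoseGas.PeriodicTrialState N L, ∀ m M : ℕ, P ≤ m + 1 → (∑ n ∈ Finset.Icc (fun _ : Fin 3 => -((M : ℤ))) (fun _ : Fin 3 => ((M : ℤ))) \ Finset.Icc (fun _ : Fin 3 => -((m : ℤ))) (fun _ : Fin 3 => ((m : ℤ))), Literature.MathematicalPhysics.QuantumManyBody.BoseGas.cellOccupation N L (fun x => ((Real.sqrt (L ^ 3))⁻¹ : ℂ) * Literature.MathematicalPhysics.QuantumManyBody.BoseGas.cellWave L n x) Ψ.ψ) ≤ ENNReal.ofReal (C * P / ((m : ℝ) + 1) * N) + ENNReal.ofReal C * ((N : ENNReal) - ∑ q : Fin 3 → Fin P, Literature.MathematicalPhysics.QuantumManyBody.BoseGas.cellOccupation N L (fun x => Literature.MathematicalPhysics.QuantumManyBody.BoseGas.constantMode (L / (P : ℝ)) (x - WithLp.toLp 2 (fun i => L / (P : ℝ) * ((q i : ℕ) : ℝ)))) Ψ.ψ)) →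
    MesoscopicTail := by
  intro hLD hFT v hv K₀ hK₀ ε hε
  obtain ⟨C, hC, hF⟩ := hFT
  have hπ : 0 < Real.pi := Real.pi_pos
  -- the box-scale parameter `Λ₀ = 4π/K₀ + 8πC/(K₀ε)`
  obtain ⟨Λ₀, hΛ₀def⟩ : ∃ Λ₀ : ℝ, Λ₀ = 4 * Real.pi / K₀ + 8 * Real.pi * C / (K₀ * ε) := ⟨_, rfl⟩
  have hΛ₁ : 4 * Real.pi / K₀ ≤ Λ₀ := hΛ₀def ▸ le_add_of_nonneg_right (by positivity)
  have hΛ₂ : 8 * Real.pi * C / (K₀ * ε) ≤ Λ₀ := hΛ₀def ▸ le_add_of_nonneg_left (by positivity)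
  have hΛ₀ : 0 < Λ₀ := lt_of_lt_of_le (by positivity) hΛ₁
  have hKΛ : 4 * Real.pi ≤ K₀ * Λ₀ := by
    have := (div_le_iff₀ hK₀).1 hΛ₁; linarith [mul_comm Λ₀ K₀]
  have hCΛ : 8 * Real.pi * C ≤ K₀ * ε * Λ₀ := by
    have := (div_le_iff₀ (by positivity : 0 < K₀ * ε)).1 hΛ₂; linarith [mul_comm Λ₀ (K₀ * ε)]
  obtain ⟨ρ₀, hρ₀, hρ⟩ := hLD v hv Λ₀ hΛ₀ (ε / (2 * C)) (by positivity)
  refine ⟨ρ₀, hρ₀, fun ρ hρpos hρlt => ?_⟩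
  have hsq : 0 < Real.sqrt ρ := Real.sqrt_pos.2 hρpos
  have hLev : ∀ᶠ N : ℕ in atTop, Λ₀ ≤ sideLength ρ N * Real.sqrt ρ :=
    ((tendsto_sideLength_atTop hρpos).atTop_mul_const hsq).eventually_ge_atTop Λ₀
  filter_upwards [hρ ρ hρpos hρlt, hLev] with N hN hLN
  obtain ⟨δ, hδ, hΨ⟩ := hN
  refine ⟨δ, hδ, ?_⟩
  generalize hLdef : sideLength ρ N = L at hΨ hLN ⊢
  intro Ψ hΨE m M hm
  -- `x = L√ρ ≥ Λ₀ > 0`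
  have hx : Λ₀ ≤ L * Real.sqrt ρ := hLN
  have hxpos : 0 < L * Real.sqrt ρ := hΛ₀.trans_le hx
  have hLpos : 0 < L := by
    by_contra h
    push Not at h
    nlinarith [mul_nonneg (neg_nonneg.2 h) hsq.le]
  -- number of boxes per side, `P = ⌈L√ρ/Λ₀⌉`
  obtain ⟨P, hPdef⟩ : ∃ P : ℕ, P = ⌈L * Real.sqrt ρ / Λ₀⌉₊ := ⟨_, rfl⟩
  have hdivpos : 0 < L * Real.sqrt ρ / Λ₀ := div_pos hxpos hΛ₀
  have hP : 0 < P := hPdef ▸ Nat.ceil_pos.2 hdivpos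
  have hPpos : (0 : ℝ) < P := by exact_mod_cast hP
  have hPle : (P : ℝ) ≤ L * Real.sqrt ρ / Λ₀ + 1 :=
    hPdef ▸ (Nat.ceil_lt_add_one hdivpos.le).le
  have hPge : L * Real.sqrt ρ / Λ₀ ≤ P := hPdef ▸ Nat.le_ceil _
  -- the boxes are at most `Λ₀/√ρ` wide
  have hscale : L / (P : ℝ) ≤ Λ₀ / Real.sqrt ρ := by
    rw [div_le_div_iff₀ hPpos hsq]
    have h1 : L * Real.sqrt ρ = (L * Real.sqrt ρ / Λ₀) * Λ₀ := by field_simp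
    calc L * Real.sqrt ρ = (L * Real.sqrt ρ / Λ₀) * Λ₀ := h1
      _ ≤ (P : ℝ) * Λ₀ := by gcongr
      _ = Λ₀ * P := mul_comm _ _
  -- `P ≤ m + 1`
  have hm' : K₀ * (L * Real.sqrt ρ) / (2 * Real.pi) ≤ (m : ℝ) + 1 := by
    simpa [mul_assoc] using hm
  have hinv : L * Real.sqrt ρ / Λ₀ ≤ K₀ * (L * Real.sqrt ρ) / (4 * Real.pi) := by
    rw [div_le_div_iff₀ hΛ₀ (by positivity)]
    nlinarith [hKΛ, hxpos, mul_le_mul_of_nonneg_left hKΛ hxpos.le]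
  have hone : (1 : ℝ) ≤ K₀ * (L * Real.sqrt ρ) / (4 * Real.pi) := by
    rw [le_div_iff₀ (by positivity), one_mul]
    nlinarith [hKΛ, hx, hK₀, mul_le_mul_of_nonneg_left hx hK₀.le]
  have hsum : K₀ * (L * Real.sqrt ρ) / (4 * Real.pi) + K₀ * (L * Real.sqrt ρ) / (4 * Real.pi) =
      K₀ * (L * Real.sqrt ρ) / (2 * Real.pi) := by ring
  have hPm_real : (P : ℝ) ≤ (m : ℝ) + 1 := by linarith
  have hPm : P ≤ m + 1 := by exact_mod_cast hPm_real
  -- the two hypotheses at work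
  have hFT' := hF N L hLpos P hP Ψ m M hPm
  have hLD' := hΨ Ψ hΨE P hP hscale
  refine hFT'.trans ?_
  generalize (∑ q : Fin 3 → Fin P, cellOccupation N L (fun x => constantMode (L / (P : ℝ))
      (x - WithLp.toLp 2 (fun i => L / (P : ℝ) * ((q i : ℕ) : ℝ)))) Ψ.ψ) = S at hLD' ⊢
  -- term 1: `C P/(m+1) ≤ ε/2`
  have hm1 : (0 : ℝ) < (m : ℝ) + 1 := by positivity
  have hratio : C * P / ((m : ℝ) + 1) ≤ ε / 2 := by
    rw [div_le_iff₀ hm1]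
    have h1 : C * (L * Real.sqrt ρ / Λ₀) ≤ ε * (K₀ * (L * Real.sqrt ρ)) / (8 * Real.pi) := by
      rw [mul_div_assoc', div_le_div_iff₀ hΛ₀ (by positivity)]
      nlinarith [hCΛ, hxpos, mul_le_mul_of_nonneg_left hCΛ hxpos.le]
    have h2 : C ≤ ε * (K₀ * (L * Real.sqrt ρ)) / (8 * Real.pi) := by
      rw [le_div_iff₀ (by positivity)]
      nlinarith [hCΛ, hx, mul_nonneg (mul_nonneg hK₀.le hε.le) (sub_nonneg.2 hx)]
    have h3 : ε * (K₀ * (L * Real.sqrt ρ)) / (8 * Real.pi) + ε * (K₀ * (L * Real.sqrt ρ)) / (8 * Real.pi)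
        = ε / 2 * (K₀ * (L * Real.sqrt ρ) / (2 * Real.pi)) := by ring
    have h4 : ε / 2 * (K₀ * (L * Real.sqrt ρ) / (2 * Real.pi)) ≤ ε / 2 * ((m : ℝ) + 1) :=
      mul_le_mul_of_nonneg_left hm' (by positivity)
    have h5 : C * (P : ℝ) ≤ C * (L * Real.sqrt ρ / Λ₀ + 1) := mul_le_mul_of_nonneg_left hPle hC.le
    linarith [h1, h2, h3, h4, h5]
  have hT1 : ENNReal.ofReal (C * P / ((m : ℝ) + 1) * N) ≤ ENNReal.ofReal (ε / 2 * N) := by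
    apply ENNReal.ofReal_le_ofReal
    exact mul_le_mul_of_nonneg_right hratio (Nat.cast_nonneg N)
  -- term 2: `C · (N - S) ≤ C · (ε/(2C)) N = (ε/2) N`
  have hsub : (N : ENNReal) - S ≤ ENNReal.ofReal (ε / (2 * C) * N) := tsub_le_iff_left.2 hLD'
  have hT2 : ENNReal.ofReal C * ((N : ENNReal) - S) ≤ ENNReal.ofReal (ε / 2 * N) := by
    calc ENNReal.ofReal C * ((N : ENNReal) - S)
        ≤ ENNReal.ofReal C * ENNReal.ofReal (ε / (2 * C) * N) := by gcongr
      _ = ENNReal.ofReal (C * (ε / (2 * C) * N)) := (ENNReal.ofReal_mul hC.le).symm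
      _ = ENNReal.ofReal (ε / 2 * N) := by
          congr 1; field_simp
  refine (add_le_add hT1 hT2).trans_eq ?_
  rw [← ENNReal.ofReal_add (by positivity) (by positivity)]
  congr 1; ring

end Summit.AtomisticToContinuum.BoseEinsteinCondensation.Theorems
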